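import Summits.Ventures.PercRepro.ExcessOneNonTightening
import Summits.Ventures.PercRepro.ExcessOneSingleton
import Summits.Ventures.PercRepro.MSTightProjectionL3

/-!
# The extension lemma: criteria, the top of a tight family, and the reductions

Dossier proofs/MINE1-theoremS.md, Addendum 53. For a family `K` of excess one
(`|K \\ K| = |K| + 1`) call a set `t ∉ K` **bad** when `t \ k ∈ K \\ K` for every member `k`
(`t` is `P₁`-eligible) and `t` lies below no member. Theorem (E) says that `t ∪ ∩K` is then a
tight one-point extension of `K`. This module holds the elementary pieces:

* `tight_insert_of_sdiff_subset`: an excess-one family together with a set whose differences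
  against the family in both directions are differences of the family is tight;
* `inter_nonempty_of_bad`: every member meets a bad set (a member disjoint from `t` would make
  `t` itself a difference `a \ b`, and then `t ⊆ a`);
* `sdiff_mem_diffs_of_forall_erase_mem`: if every `t.erase g` (`g ∈ t`) is a member, the
  differences `k \ t` are differences of `K` — the "(A*)" reduction;
* `erase_mem_of_tight_of_maximal` (**MaxErase**): a maximal member of a tight family minus any
  element of its support (twin-free at that element) is again a member — Theorem S's flip along
  the addable part `Rstar`, which a maximal member contains.
-/

namespace PercRepro.MSTight

open Finset
open scoped FinsetFamily symmDiff

variable {α : Type*} [DecidableEq α]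

section Criteria

/-- The differences of `insert t K` are those of `K` together with the differences against `t`. -/
theorem diffs_insert_eq (K : Finset (Finset α)) (t : Finset α) :
    insert t K \\ insert t K = K \\ K ∪ K \\ {t} ∪ {t} \\ K ∪ {t} \\ {t} := by
  rw [insert_eq, diffs_union_left, diffs_union_right, diffs_union_right]
  ext E
  simp only [mem_union]
  tauto

/-- **Tightness criterion.** If `|K \\ K| = |K| + 1`, `t ∉ K`, and both `t \ k` and `k \ t` are
differences of `K` for every `k ∈ K`, then `insert t K` is tight (with the same differences). -/
theorem tight_insert_of_sdiff_subset {K : Finset (Finset α)} {t : Finset α}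
    (hK : (K \\ K).card = K.card + 1) (htK : t ∉ K)
    (h1 : ∀ k ∈ K, t \ k ∈ K \\ K) (h2 : ∀ k ∈ K, k \ t ∈ K \\ K) : Tight (insert t K) := by
  have hD : insert t K \\ insert t K = K \\ K := by
    refine Subset.antisymm ?_ (diffs_subset (subset_insert t K) (subset_insert t K))
    rw [diffs_insert_eq]
    intro E hE
    simp only [mem_union, mem_diffs, mem_singleton] at hE
    rcases hE with ((hE | hE) | hE) | hE
    · exact mem_diffs.2 hE
    · obtain ⟨a, ha, b, rfl, rfl⟩ := hE
      exact h2 a ha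
    · obtain ⟨a, rfl, b, hb, rfl⟩ := hE
      exact h1 b hb
    · obtain ⟨a, rfl, b, rfl, rfl⟩ := hE
      obtain ⟨k, hk⟩ : K.Nonempty := by
        by_contra h
        rw [not_nonempty_iff_eq_empty] at h
        subst h
        simp at hK
      rw [Finset.sdiff_self]
      have := h1 k hk
      exact mem_diffs.2 ⟨k, hk, k, hk, Finset.sdiff_self k⟩
  unfold Tight
  rw [hD, hK, card_insert_of_notMem htK]

/-- Every member of `K` meets a bad set `t`: otherwise `t = t \ k` is a difference `a \ b` of
`K`, and `t ⊆ a`. -/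
theorem inter_nonempty_of_bad {K : Finset (Finset α)} {t : Finset α}
    (h1 : ∀ k ∈ K, t \ k ∈ K \\ K) (hnot : ∀ k ∈ K, ¬ t ⊆ k) {k : Finset α} (hk : k ∈ K) :
    (k ∩ t).Nonempty := by
  rw [nonempty_iff_ne_empty]
  intro h
  have ht : t \ k = t := by
    rw [Finset.sdiff_eq_self_iff_disjoint, disjoint_iff_inter_eq_empty, inter_comm]
    exact h
  have := h1 k hk
  rw [ht] at this
  obtain ⟨a, ha, b, -, hab⟩ := mem_diffs.1 this
  exact hnot a ha (hab ▸ sdiff_subset)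

/-- **The (A*) reduction.** If `t.erase g ∈ K` for every `g ∈ t`, then `k \ t` is a difference of
`K` for every member `k` not containing `t`: pick `g ∈ t \ k`, then `k \ t = k \ t.erase g`. -/
theorem sdiff_mem_diffs_of_forall_erase_mem {K : Finset (Finset α)} {t : Finset α}
    (h : ∀ g ∈ t, t.erase g ∈ K) {k : Finset α} (hk : k ∈ K) (hnot : ¬ t ⊆ k) :
    k \ t ∈ K \\ K := by
  obtain ⟨g, hgt, hgk⟩ := not_subset.1 hnot
  have e : k \ t = k \ t.erase g := by
    ext x
    simp only [mem_sdiff, mem_erase]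
    constructor
    · rintro ⟨hxk, hxt⟩
      exact ⟨hxk, fun h => hxt h.2⟩
    · rintro ⟨hxk, hxt⟩
      refine ⟨hxk, fun hx => hxt ⟨?_, hx⟩⟩
      rintro rfl
      exact hgk hxk
  rw [e]
  exact mem_diffs.2 ⟨k, hk, t.erase g, h g hgt, rfl⟩

end Criteria

section MaxErase

variable [Fintype α]

/-- A maximal member of a family contains its addable part. -/
theorem Rstar_subset_of_maximal {T : Finset (Finset α)} {m : Finset α} (hm : m ∈ T)
    (hmax : ∀ A ∈ T, m ⊆ A → A = m) : Rstar T ⊆ m := by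
  intro a ha
  have hadd : ClosedAdd T (cls T a) := mem_Rstar.1 ha
  have h1 : m ∪ cls T a ∈ T := hadd m hm
  have h2 : m ∪ cls T a = m := hmax _ h1 subset_union_left
  have h3 : a ∈ m ∪ cls T a := mem_union_right _ (mem_cls.2 (twin_refl T a))
  rwa [h2] at h3

/-- Removing an element with a singleton twin class from a twin-closed set keeps it twin-closed. -/
theorem twinClosed_erase {T : Finset (Finset α)} {W : Finset α} (hW : TwinClosed T W) {g : α}
    (hg : cls T g = {g}) : TwinClosed T (W.erase g) := by
  intro a b hab ha
  rw [mem_erase] at ha ⊢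
  refine ⟨?_, hW a b hab ha.2⟩
  rintro rfl
  have : a ∈ cls T b := mem_cls.2 hab.symm
  rw [hg, mem_singleton] at this
  exact ha.1 this

/-- **MaxErase.** In a tight family `T`, a maximal member `m` minus an element `g ∈ m` whose twin
class is `{g}` and which some member avoids is again a member. -/
theorem erase_mem_of_tight_of_maximal {T : Finset (Finset α)} (hT : Tight T) {m : Finset α}
    (hm : m ∈ T) (hmax : ∀ A ∈ T, m ⊆ A → A = m) {g : α} (hgm : g ∈ m) (hcls : cls T g = {g})
    (hout : ∃ A ∈ T, g ∉ A) : m.erase g ∈ T := by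
  set R := Rstar T with hR
  have hRm : R ⊆ m := Rstar_subset_of_maximal hm hmax
  have hD := dichotomy_of_tight hT
  -- the flipped maximal member is `m \ R`
  have hmR : m ∆ R = m \ R := by
    ext x
    simp only [mem_symmDiff, mem_sdiff]
    constructor
    · rintro (h | h)
      · exact h
      · exact absurd (hRm h.1) h.2
    · intro h
      exact Or.inl h
  have hW : m \ R ∈ flip R T := by
    rw [← hmR]
    exact symmDiff_mem_flip hm
  -- it suffices to find a member `A` with `A ∆ R = m.erase g ∆ R`
  suffices hsuff : (m.erase g) ∆ R ∈ flip R T by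
    obtain ⟨A, hA, hAR⟩ := mem_flip.1 hsuff
    have : A = m.erase g := by
      have h := congrArg (fun S => S ∆ R) hAR
      simp only [symmDiff_symmDiff_cancel_right] at h
      exact h
    rw [← this]
    exact hA
  by_cases hgR : g ∈ R
  · -- `g` addable: `{g}` is a difference inside `R`, `m \ R` one outside; the flip is their product
    obtain ⟨A, hA, hgA⟩ := hout
    have hg1 : ({g} : Finset α) ∈ T \\ T := by
      have := cls_mem_diffs_of_tight hT hm hgm hA hgA
      rwa [hcls] at this
    rw [diffs_eq_flip_of_tight hT] at hg1
    have hprod := flip_eq_sups_within_of_tight hT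
    have hX : m \ R ∈ within (flip R T) (Finset.univ \ R) :=
      mem_within.2 ⟨hW, fun x hx => mem_sdiff.2 ⟨mem_univ x, (mem_sdiff.1 hx).2⟩⟩
    have hY : ({g} : Finset α) ∈ within (flip R T) R :=
      mem_within.2 ⟨hg1, singleton_subset_iff.2 hgR⟩
    have hmem : (m \ R) ∪ {g} ∈ flip R T := by
      rw [hprod]
      exact mem_sups.2 ⟨m \ R, hX, {g}, hY, rfl⟩
    have e : (m.erase g) ∆ R = (m \ R) ∪ {g} := by
      ext x
      simp only [mem_symmDiff, mem_sdiff, mem_erase, mem_union, mem_singleton]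
      constructor
      · rintro (⟨⟨hxg, hxm⟩, hxR⟩ | ⟨hxR, hx⟩)
        · exact Or.inl ⟨hxm, hxR⟩
        · right
          by_contra hxg
          exact hx ⟨hxg, hRm hxR⟩
      · rintro (⟨hxm, hxR⟩ | rfl)
        · left
          refine ⟨⟨?_, hxm⟩, hxR⟩
          rintro rfl
          exact hxR hgR
        · right
          exact ⟨hgR, fun h => h.1 rfl⟩
    rw [e]
    exact hmem
  · -- `g` removable: `(m.erase g) ∆ R` is a twin-closed subset of the flipped member `m ∆ R`
    have e : (m.erase g) ∆ R = (m \ R).erase g := by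
      ext x
      simp only [mem_symmDiff, mem_sdiff, mem_erase]
      constructor
      · rintro (⟨⟨hxg, hxm⟩, hxR⟩ | ⟨hxR, hx⟩)
        · exact ⟨hxg, hxm, hxR⟩
        · exfalso
          refine hx ⟨?_, hRm hxR⟩
          rintro rfl
          exact hgR hxR
      · rintro ⟨hxg, hxm, hxR⟩
        exact Or.inl ⟨⟨hxg, hxm⟩, hxR⟩
    rw [e]
    exact mem_flip_of_subset_of_twinClosed hD hW (erase_subset g (m \ R))
      (twinClosed_erase (twinClosed_of_mem_flip hW) hcls)

end MaxErase

end PercRepro.MSTight
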